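import Literature.AlgebraicGeometry.RelativeSpec.GeometricQuotient
import Literature.AlgebraicGeometry.Resolution.SmoothStalksRegular
import Literature.AlgebraicGeometry.Resolution.RegularLocalRingsNormal
import Literature.AlgebraicGeometry.Motives.SmoothOverRegularBase
import Literature.AlgebraicGeometry.Motives.VarietiesDimensionProofs
import Literature.AlgebraicGeometry.Dimension.SmoothRelativeDimensionOfClosedPoints
import Literature.RingTheory.KrullDimension.AffineDimension
import Mathlib.AlgebraicGeometry.Morphisms.Smooth
import Mathlib.RingTheory.Invariant.Basic
import Mathlib.RingTheory.LocalProperties.Reduced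
import Mathlib.RingTheory.Ideal.Height
import HarnessLib

/-!
# The quotient of a smooth curve over a perfect field by a finite group is a smooth curve
# ([SGA1] Exp. V §1; [MumfordAV1970] §7; [GortzWedhorn2020] Prop. 6.42)

FIELD CASE of `RelativeSpec/GeometricQuotientTameSmoothCurve`: let `κ` be a perfect field,
`p : Z → Z'` an AFFINE geometric quotient (`ActionOver.IsGeometricQuotient`, Mumford's (1), (2)) of
`Z` by a finite group `G` acting over `Z'`, and `t : Z' → Spec κ` locally of finite type with
`p ≫ t : Z → Spec κ` smooth of relative dimension `1`.  Then `t` is smooth of relative dimension `1`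
(`ActionOver.IsGeometricQuotient.smoothOfRelativeDimension_one_of_field`) — the hypothesis `hfield`
of ★ `ActionOver.smoothOfRelativeDimension_one_gluedDesc_of_fieldCase`.

Proof, chart by chart on affine opens `W ⊆ Z'` (so that `p⁻¹W` is affine): the ring
`C = Γ(Z, p⁻¹W)` is a reduced `κ`-algebra of finite type whose local rings are regular of
dimension `≤ 1` (★ `Resolution.isRegularLocalRing_stalk_of_smooth_of_field`,
★ `Motives.ringKrullDim_stalk_le_of_smoothOfRelativeDimension`), hence integrally closed domains
(★ `Resolution.isDomain_of_isRegularLocalRing`, ★ `Resolution.isIntegrallyClosed_of_isRegularLocalRing`);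
`G` acts on `C` by `κ`-algebra automorphisms (★ `ActionOver.mulSemiringAction`) and
`D = Γ(Z', W) ≅ C^G` (★ `IsGeometricQuotient.app_injective`, `range_app`).  The RING-LEVEL statement
«the invariants of such a `C` form a smooth `κ`-algebra» (normality of the orbit blocks of `C^G`,
[KnusEtAl1998] (18.18); normal of dimension `1` over a perfect field ⇒ smooth, [GortzWedhorn2020]
Prop. 6.42) is taken as the hypothesis `hRing`, verbatim the statement of the companion ring file;
then `Γ(Spec κ) → D` is smooth, so `t` is smooth (Mathlib `HasRingHomProperty @Smooth RingHom.Smooth`).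
The relative dimension is read at closed points `z ∈ Z'` (★
`Dimension.smoothOfRelativeDimension_of_forall_isClosed_ringKrullDim_stalk_eq`): `dim 𝒪_{Z',z} = ht 𝔪_z = 1`
because `C` is integral over `D` (Mathlib `Algebra.IsInvariant.isIntegral`) — so `dim D = dim C ≤ 1`
(★ `KrullDimension.ringKrullDim_eq_of_isIntegral`) — and a maximal ideal of `C` over `𝔪_z` has height
`1` (★ `Dimension.ringKrullDim_stalk_eq_of_smoothOfRelativeDimension_of_isClosed`), which
incomparability (Mathlib `Ideal.IsIntegral.comap_lt_comap`) pushes down to `ht 𝔪_z ≥ 1`.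

* `sections_isRegularRing_of_smooth`, `sections_isReduced_of_smooth`,
  `ringKrullDim_sections_le_of_smoothOfRelativeDimension` — the chart ring of a smooth curve;
* `IsGeometricQuotient.smooth_of_field` — `t` is smooth (modulo `hRing`);
* `IsGeometricQuotient.ringKrullDim_stalk_eq_one_of_isClosed` — `dim 𝒪_{Z',z} = 1` at closed points;
* `IsGeometricQuotient.smoothOfRelativeDimension_one_of_field` — the field case (modulo `hRing`).

Everything is proved; no named facts, no definitions; the ring-level statement enters as an
explicit hypothesis.

Mathlib searched (pin): `HasRingHomProperty.of_iSup_eq_top`, `RingHom.Smooth.respectsIso`,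
`Algebra.Smooth.of_equiv`, `Algebra.IsInvariant.isIntegral`, `Ideal.exists_ideal_over_maximal_of_isIntegral`,
`Ideal.IsIntegral.comap_lt_comap`, `ringKrullDim_le_iff_isMaximal_height_le`, `Ideal.height_eq_zero_iff`,
`IsLocalization.AtPrime.ringKrullDim_eq_height`, `IsAffineOpen.isLocalization_stalk`,
`IsAffineOpen.fromSpec_primeIdealOf`, `isReduced_ofLocalizationMaximal` (all used).

## References

* A. Grothendieck, *SGA 1*, Exp. V §1, Prop. 1.8, Cor. 1.5. [SGA1]
* D. Mumford, *Abelian Varieties* (1970), §7, Thm. p. 66. [MumfordAV1970]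
* U. Görtz, T. Wedhorn, *Algebraic Geometry I*, 2nd ed. (2020), Prop. 6.42, Lemma 6.26, Thm. 6.28.
  [GortzWedhorn2020]
* M.-A. Knus, A. Merkurjev, M. Rost, J.-P. Tignol, *The Book of Involutions* (1998), Prop. (18.18).
  [KnusEtAl1998]
* H. Matsumura, *Commutative Ring Theory* (1986), Thm. 9.4, Thm. 11.2. [Matsumura1987]
-/

noncomputable section

universe u

open CategoryTheory Limits AlgebraicGeometry Opposite TopologicalSpace

namespace Literature.AlgebraicGeometry.RelativeSpec

/-! ### §0 The chart ring of a smooth curve over a field -/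

section Chart

variable {κ : Type u} [Field κ] {Z : Scheme.{u}} (s : Z ⟶ Spec (.of κ))

/-- The ring of sections of an affine open of a scheme smooth over a field is a regular ring
(its local rings are regular, [GortzWedhorn2020] Lemma 6.26 / Stacks 056S).
[cite: GortzWedhorn2020, Lemma 6.26] -/
theorem sections_isRegularRing_of_smooth [Smooth s] {O : Z.Opens} (hO : IsAffineOpen O) :
    IsRegularRing Γ(Z, O) := by
  haveI : IsLocallyNoetherian Z := LocallyOfFiniteType.isLocallyNoetherian s
  exact Motives.isRegularRing_of_isAffineOpen hO
    fun z => Resolution.isRegularLocalRing_stalk_of_smooth_of_field s z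

/-- The localisations of the chart ring of a smooth scheme over a field at its primes are integrally
closed domains (regular local rings are normal domains, [Matsumura1987] Thm. 14.3, 19.4).
[cite: GortzWedhorn2020, Lemma 6.26] [cite: Matsumura1987, Thm. 19.4] -/
theorem isDomain_and_isIntegrallyClosed_localization_sections_of_smooth [Smooth s] {O : Z.Opens}
    (hO : IsAffineOpen O) (P : Ideal Γ(Z, O)) [P.IsPrime] :
    IsDomain (Localization.AtPrime P) ∧ IsIntegrallyClosed (Localization.AtPrime P) := by
  haveI : IsLocallyNoetherian Z := LocallyOfFiniteType.isLocallyNoetherian s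
  haveI : IsNoetherianRing Γ(Z, O) := IsLocallyNoetherian.component_noetherian ⟨O, hO⟩
  haveI : IsRegularLocalRing (Localization.AtPrime P) :=
    (isRegularRing_iff.mp (sections_isRegularRing_of_smooth s hO)) P
  exact ⟨Resolution.isDomain_of_isRegularLocalRing (Localization.AtPrime P),
    Resolution.isIntegrallyClosed_of_isRegularLocalRing (Localization.AtPrime P)⟩

/-- The chart ring of a smooth scheme over a field is reduced. [cite: GortzWedhorn2020, Lemma 6.26] -/
theorem sections_isReduced_of_smooth [Smooth s] {O : Z.Opens} (hO : IsAffineOpen O) :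
    IsReduced Γ(Z, O) :=
  isReduced_ofLocalizationMaximal Γ(Z, O) fun J hJ => by
    haveI := hJ
    haveI := (isDomain_and_isIntegrallyClosed_localization_sections_of_smooth s hO J).1
    infer_instance

/-- **The chart ring of a smooth curve has Krull dimension `≤ 1`**: for `s : Z → Spec κ` smooth of
relative dimension `n` and an affine open `O`, `dim Γ(Z, O) ≤ n` (the heights of the maximal ideals are
the dimensions of the local rings, [GortzWedhorn2020] Lemma 6.26). [cite: GortzWedhorn2020, Lemma 6.26] -/
theorem ringKrullDim_sections_le_of_smoothOfRelativeDimension (n : ℕ) [SmoothOfRelativeDimension n s]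
    {O : Z.Opens} (hO : IsAffineOpen O) : ringKrullDim Γ(Z, O) ≤ n := by
  rw [ringKrullDim_le_iff_isMaximal_height_le]
  intro m hm
  let P : PrimeSpectrum Γ(Z, O) := ⟨m, hm.isPrime⟩
  let z : Z := hO.fromSpec P
  have hz : z ∈ O := by
    have : z ∈ Set.range hO.fromSpec := Set.mem_range_self P
    rwa [IsAffineOpen.range_fromSpec] at this
  letI : Algebra Γ(Z, O) (Z.presheaf.stalk z) := TopCat.Presheaf.algebra_section_stalk Z.presheaf ⟨z, hz⟩
  have hP : hO.primeIdealOf ⟨z, hz⟩ = P := by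
    apply hO.fromSpec.isOpenEmbedding.injective
    rw [IsAffineOpen.fromSpec_primeIdealOf]
  have hloc : IsLocalization.AtPrime (Z.presheaf.stalk z) (hO.primeIdealOf ⟨z, hz⟩).asIdeal :=
    hO.isLocalization_stalk ⟨z, hz⟩
  rw [hP] at hloc
  haveI := hm.isPrime
  have h1 : ringKrullDim (Z.presheaf.stalk z) = m.height :=
    IsLocalization.AtPrime.ringKrullDim_eq_height m (Z.presheaf.stalk z)
  have h2 := Motives.ringKrullDim_stalk_le_of_smoothOfRelativeDimension s n z
  rw [h1] at h2
  exact_mod_cast h2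

end Chart

/-! ### §1 The quotient is smooth (chartwise, modulo the ring-level statement `hRing`) -/

namespace ActionOver.IsGeometricQuotient

variable {κ : Type u} [Field κ] {Z Z' : Scheme.{u}} {p : Z ⟶ Z'} {G : Type u} [Group G]
  {ρ : ActionOver p G} (hq : ρ.IsGeometricQuotient p) (t : Z' ⟶ Spec (.of κ))

set_option backward.isDefEq.respectTransparency false

include hq in
/-- **Chartwise smoothness of the quotient of a smooth curve over a perfect field.**  For an affine
geometric quotient `p : Z → Z'` by the finite group `G`, `t : Z' → Spec κ` locally of finite type with
`p ≫ t` smooth of relative dimension `1`, `κ` perfect, and an affine open `W ⊆ Z'`: the structure map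
`Γ(Spec κ) → Γ(Z', W)` is smooth.  The chart ring `C = Γ(Z, p⁻¹W)` is a reduced `κ`-algebra of finite
type, locally an integrally closed domain, of dimension `≤ 1`, on which `G` acts by `κ`-algebra
automorphisms with `Γ(Z', W) ≅ C^G` (Mumford's (2)); the ring-level statement `hRing` («the invariants of
such a `C` are a smooth `κ`-algebra») is the hypothesis.
[cite: SGA1, Exp. V §1, Prop. 1.8] [cite: MumfordAV1970, §7 Thm. p. 66 (2)] [cite: GortzWedhorn2020, Prop. 6.42] -/
theorem smooth_appLE_top_of_field [Finite G] [PerfectField κ] [IsAffineHom p]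
    [SmoothOfRelativeDimension 1 (p ≫ t)] [LocallyOfFiniteType t]
    (hRing : ∀ (l A : Type u) [Field l] [PerfectField l] [CommRing A] [Algebra l A]
      [Algebra.FiniteType l A] [IsReduced A] [MulSemiringAction G A] [SMulCommClass G l A],
      (∀ m : Ideal A, [m.IsMaximal] → IsDomain (Localization.AtPrime m)) →
      (∀ m : Ideal A, [m.IsMaximal] → IsIntegrallyClosed (Localization.AtPrime m)) →
      ringKrullDim A ≤ 1 → Algebra.Smooth l ↥(FixedPoints.subalgebra l A G))
    (W : Z'.affineOpens) : (t.appLE ⊤ W le_top).hom.Smooth := by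
  haveI : Smooth (p ≫ t) := SmoothOfRelativeDimension.smooth 1 _
  let O : Z.Opens := p ⁻¹ᵁ W.1
  have hO : IsAffineOpen O := W.2.preimage p
  have hOle : O ≤ (p ≫ t) ⁻¹ᵁ ⊤ := le_top
  -- the rings and their `κ`-algebra structures
  let eκ : Γ(Spec (.of κ), ⊤) ≅ CommRingCat.of κ := Scheme.ΓSpecIso (.of κ)
  let φD : κ →+* Γ(Z', W.1) := (t.appLE ⊤ W.1 le_top).hom.comp eκ.inv.hom
  let φC : κ →+* Γ(Z, O) := ((p ≫ t).appLE ⊤ O hOle).hom.comp eκ.inv.hom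
  letI algD : Algebra κ Γ(Z', W.1) := φD.toAlgebra
  letI algC : Algebra κ Γ(Z, O) := φC.toAlgebra
  letI algDC : Algebra Γ(Z', W.1) Γ(Z, O) := (p.app W.1).hom.toAlgebra
  have happ : p.app W.1 = p.appLE W.1 O le_rfl := Scheme.Hom.app_eq_appLE p
  have hcomp : (p.app W.1).hom.comp (t.appLE ⊤ W.1 le_top).hom = ((p ≫ t).appLE ⊤ O hOle).hom := by
    rw [happ]
    change (t.appLE ⊤ W.1 le_top ≫ p.appLE W.1 O le_rfl).hom = _
    rw [Scheme.Hom.appLE_comp_appLE]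
  haveI : IsScalarTower κ Γ(Z', W.1) Γ(Z, O) := IsScalarTower.of_algebraMap_eq' (by
    change φC = (p.app W.1).hom.comp φD
    simp only [φC, φD, ← RingHom.comp_assoc, hcomp])
  -- the action of `G` on `C` by `κ`-algebra automorphisms
  letI := ρ.mulSemiringAction W.1
  have hinvD : ∀ (g : G) (d : Γ(Z', W.1)), g • (algebraMap Γ(Z', W.1) Γ(Z, O) d) =
      algebraMap Γ(Z', W.1) Γ(Z, O) d := fun g d => ρ.act_app g W.1 d
  haveI : SMulCommClass G κ Γ(Z, O) := ⟨fun g c x => by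
    rw [Algebra.smul_def, Algebra.smul_def, smul_mul', IsScalarTower.algebraMap_apply κ Γ(Z', W.1) Γ(Z, O),
      hinvD]⟩
  -- the chart ring of the smooth curve
  haveI : Algebra.FiniteType κ Γ(Z, O) := by
    have h1 : ((p ≫ t).appLE ⊤ O hOle).hom.FiniteType :=
      HasRingHomProperty.appLE @LocallyOfFiniteType (p ≫ t) inferInstance ⟨⊤, isAffineOpen_top _⟩ ⟨O, hO⟩ hOle
    have h2 : φC.FiniteType :=
      RingHom.finiteType_respectsIso.2 ((p ≫ t).appLE ⊤ O hOle).hom eκ.symm.commRingCatIsoToRingEquiv h1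
    exact h2
  haveI : IsReduced Γ(Z, O) := sections_isReduced_of_smooth (p ≫ t) hO
  have hS : Algebra.Smooth κ ↥(FixedPoints.subalgebra κ Γ(Z, O) G) :=
    hRing κ Γ(Z, O)
      (fun m _ => (isDomain_and_isIntegrallyClosed_localization_sections_of_smooth (p ≫ t) hO m).1)
      (fun m _ => (isDomain_and_isIntegrallyClosed_localization_sections_of_smooth (p ≫ t) hO m).2)
      (ringKrullDim_sections_le_of_smoothOfRelativeDimension (p ≫ t) 1 hO)
  -- `Γ(Z', W) ≅ C^G`
  let ψ : Γ(Z', W.1) →ₐ[κ] Γ(Z, O) := IsScalarTower.toAlgHom κ Γ(Z', W.1) Γ(Z, O)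
  have hψ : ∀ d, ψ d = p.app W.1 d := fun d => rfl
  have hmem : ∀ d, ψ d ∈ FixedPoints.subalgebra κ Γ(Z, O) G := fun d g => hinvD g d
  have hbij : Function.Bijective (ψ.codRestrict (FixedPoints.subalgebra κ Γ(Z, O) G) hmem) := by
    refine ⟨fun a b hab => hq.app_injective W.1 (by simpa [hψ] using congrArg Subtype.val hab),
      fun x => ?_⟩
    have hx : (x : Γ(Z, O)) ∈ Set.range (p.app W.1) := by
      rw [hq.range_app W.1]
      exact fun g => x.2 g
    obtain ⟨d, hd⟩ := hx
    exact ⟨d, Subtype.ext (by rw [AlgHom.coe_codRestrict, hψ, hd])⟩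
  let e : Γ(Z', W.1) ≃ₐ[κ] ↥(FixedPoints.subalgebra κ Γ(Z, O) G) := AlgEquiv.ofBijective _ hbij
  haveI := hS
  haveI : Algebra.Smooth κ Γ(Z', W.1) := Algebra.Smooth.of_equiv e.symm
  -- transport along `Γ(Spec κ, ⊤) ≅ κ`
  have hφD : φD.Smooth := ‹Algebra.Smooth κ Γ(Z', W.1)›
  have h := RingHom.Smooth.respectsIso.2 φD eκ.commRingCatIsoToRingEquiv hφD
  have heq : (t.appLE ⊤ W.1 le_top).hom = φD.comp eκ.commRingCatIsoToRingEquiv.toRingHom := by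
    ext x
    have hx : eκ.inv.hom (eκ.hom.hom x) = x := by
      rw [← CommRingCat.comp_apply, eκ.hom_inv_id, CommRingCat.id_apply]
    change (t.appLE ⊤ W.1 le_top).hom x = (t.appLE ⊤ W.1 le_top).hom (eκ.inv.hom (eκ.hom.hom x))
    rw [hx]
  rw [heq]
  exact h

include hq in
/-- **The quotient of a smooth curve over a perfect field by a finite group is smooth** (modulo the
ring-level statement `hRing`): smoothness is affine-local on `Z'` (Mathlib
`HasRingHomProperty @Smooth RingHom.Smooth`). [cite: SGA1, Exp. V §1, Prop. 1.8] [cite: GortzWedhorn2020, Prop. 6.42] -/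
theorem smooth_of_field [Finite G] [PerfectField κ] [IsAffineHom p]
    [SmoothOfRelativeDimension 1 (p ≫ t)] [LocallyOfFiniteType t]
    (hRing : ∀ (l A : Type u) [Field l] [PerfectField l] [CommRing A] [Algebra l A]
      [Algebra.FiniteType l A] [IsReduced A] [MulSemiringAction G A] [SMulCommClass G l A],
      (∀ m : Ideal A, [m.IsMaximal] → IsDomain (Localization.AtPrime m)) →
      (∀ m : Ideal A, [m.IsMaximal] → IsIntegrallyClosed (Localization.AtPrime m)) →
      ringKrullDim A ≤ 1 → Algebra.Smooth l ↥(FixedPoints.subalgebra l A G)) :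
    Smooth t :=
  HasRingHomProperty.of_iSup_eq_top (P := @Smooth) (fun W : Z'.affineOpens => W)
    (iSup_affineOpens_eq_top Z') fun W => hq.smooth_appLE_top_of_field t hRing W


/-! ### §2 The relative dimension: `dim 𝒪_{Z',z} = 1` at closed points -/

/-- A maximal ideal of the ring of an affine open of a Jacobson scheme (e.g. a scheme locally of finite
type over a field) is the prime of a CLOSED point of the ambient scheme. [folklore] -/
private theorem isClosed_singleton_fromSpec_of_isMaximal {X : Scheme.{u}} [JacobsonSpace X]
    {U : X.Opens} (hU : IsAffineOpen U) (P : PrimeSpectrum Γ(X, U)) (hP : P.asIdeal.IsMaximal) :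
    IsClosed ({hU.fromSpec P} : Set X) := by
  apply isClosed_singleton_of_isLocallyClosed_singleton
  have h1 : IsLocallyClosed ({P} : Set (PrimeSpectrum Γ(X, U))) :=
    ((PrimeSpectrum.isClosed_singleton_iff_isMaximal P).mpr hP).isLocallyClosed
  have h2 := h1.image hU.fromSpec.isOpenEmbedding.isInducing
    (by rw [IsAffineOpen.range_fromSpec]; exact U.2.isLocallyClosed)
  rwa [Set.image_singleton] at h2

include hq in
/-- **`dim 𝒪_{Z',z} = 1` at every closed point of the quotient of a smooth curve.**  With `W ∋ z` an
affine chart, `D = Γ(Z', W) ⊆ C = Γ(Z, p⁻¹W)` is the ring of invariants, so `C` is integral over `D`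
(Mathlib `Algebra.IsInvariant.isIntegral`) and `dim D = dim C ≤ 1`; a maximal ideal of `C` over `𝔪_z`
is the prime of a closed point of `Z`, of height `1`, and incomparability pushes a prime strictly
below it down to a prime strictly below `𝔪_z`. [cite: Matsumura1987, Thm. 9.4] [cite: GortzWedhorn2020, Lemma 6.26] -/
theorem ringKrullDim_stalk_eq_one_of_isClosed [Finite G] [IsAffineHom p]
    [SmoothOfRelativeDimension 1 (p ≫ t)] [LocallyOfFiniteType t] {z : Z'}
    (hz : IsClosed ({z} : Set Z')) : ringKrullDim (Z'.presheaf.stalk z) = (1 : ℕ) := by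
  haveI : Smooth (p ≫ t) := SmoothOfRelativeDimension.smooth 1 _
  haveI : JacobsonSpace Z := LocallyOfFiniteType.jacobsonSpace (p ≫ t)
  haveI : IsLocallyNoetherian Z' := LocallyOfFiniteType.isLocallyNoetherian t
  haveI : IsLocallyNoetherian Z := LocallyOfFiniteType.isLocallyNoetherian (p ≫ t)
  -- an affine chart `W ∋ z`
  obtain ⟨W, hzW⟩ : ∃ W : Z'.affineOpens, z ∈ (W : Z'.Opens) := by
    have h : z ∈ (⊤ : Z'.Opens) := trivial
    rwa [← iSup_affineOpens_eq_top Z', Opens.mem_iSup] at h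
  let O : Z.Opens := p ⁻¹ᵁ W.1
  have hO : IsAffineOpen O := W.2.preimage p
  haveI : IsNoetherianRing Γ(Z', W.1) := IsLocallyNoetherian.component_noetherian W
  haveI : IsNoetherianRing Γ(Z, O) := IsLocallyNoetherian.component_noetherian ⟨O, hO⟩
  -- `D ⊆ C` is the ring of invariants, so `C` is integral over `D`
  letI algDC : Algebra Γ(Z', W.1) Γ(Z, O) := (p.app W.1).hom.toAlgebra
  letI := ρ.mulSemiringAction W.1
  haveI : Algebra.IsInvariant Γ(Z', W.1) Γ(Z, O) G := ⟨fun b hb => by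
    have h : b ∈ Set.range (p.app W.1) := by rw [hq.range_app W.1]; exact hb
    exact h⟩
  haveI : Algebra.IsIntegral Γ(Z', W.1) Γ(Z, O) := Algebra.IsInvariant.isIntegral Γ(Z', W.1) Γ(Z, O) G
  have hinj : Function.Injective (algebraMap Γ(Z', W.1) Γ(Z, O)) := hq.app_injective W.1
  have hdimD : ringKrullDim Γ(Z', W.1) ≤ 1 := by
    rw [Literature.RingTheory.KrullDimension.ringKrullDim_eq_of_isIntegral hinj]
    exact ringKrullDim_sections_le_of_smoothOfRelativeDimension (p ≫ t) 1 hO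
  -- the prime `𝔪` of `z`, maximal, with `dim 𝒪_{Z',z} = ht 𝔪`
  let 𝔪 : Ideal Γ(Z', W.1) := (W.2.primeIdealOf ⟨z, hzW⟩).asIdeal
  haveI h𝔪 : 𝔪.IsMaximal := W.2.primeIdealOf_isMaximal_of_isClosed ⟨z, hzW⟩ hz
  letI : Algebra Γ(Z', W.1) (Z'.presheaf.stalk z) :=
    TopCat.Presheaf.algebra_section_stalk Z'.presheaf ⟨z, hzW⟩
  have hloc : IsLocalization.AtPrime (Z'.presheaf.stalk z) 𝔪 := W.2.isLocalization_stalk ⟨z, hzW⟩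
  rw [IsLocalization.AtPrime.ringKrullDim_eq_height 𝔪 (Z'.presheaf.stalk z)]
  -- `ht 𝔪 ≤ 1`
  have hle : 𝔪.height ≤ 1 := by
    have h := (Ideal.height_le_ringKrullDim_of_isPrime (I := 𝔪)).trans hdimD
    exact_mod_cast h
  -- a maximal `𝔐` of `C` over `𝔪`: the prime of a closed point `x` of `Z`, of height `1`
  obtain ⟨𝔐, h𝔐max, h𝔐𝔪⟩ := Ideal.exists_ideal_over_maximal_of_isIntegral (S := Γ(Z, O)) 𝔪
    (by rw [(RingHom.injective_iff_ker_eq_bot _).mp hinj]; exact bot_le)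
  let P : PrimeSpectrum Γ(Z, O) := ⟨𝔐, h𝔐max.isPrime⟩
  let x : Z := hO.fromSpec P
  have hx : x ∈ O := by
    have : x ∈ Set.range hO.fromSpec := Set.mem_range_self P
    rwa [IsAffineOpen.range_fromSpec] at this
  have hxcl : IsClosed ({x} : Set Z) := isClosed_singleton_fromSpec_of_isMaximal hO P h𝔐max
  have hP : hO.primeIdealOf ⟨x, hx⟩ = P := by
    apply hO.fromSpec.isOpenEmbedding.injective
    rw [IsAffineOpen.fromSpec_primeIdealOf]
  letI : Algebra Γ(Z, O) (Z.presheaf.stalk x) := TopCat.Presheaf.algebra_section_stalk Z.presheaf ⟨x, hx⟩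
  have hlocx : IsLocalization.AtPrime (Z.presheaf.stalk x) (hO.primeIdealOf ⟨x, hx⟩).asIdeal :=
    hO.isLocalization_stalk ⟨x, hx⟩
  rw [hP] at hlocx
  haveI := h𝔐max.isPrime
  have h𝔐ht : 𝔐.height = 1 := by
    have h1 := Dimension.ringKrullDim_stalk_eq_of_smoothOfRelativeDimension_of_isClosed (p ≫ t) 1 hxcl
    rw [IsLocalization.AtPrime.ringKrullDim_eq_height 𝔐 (Z.presheaf.stalk x)] at h1
    exact_mod_cast h1
  -- a prime strictly below `𝔐` pushes down to a prime strictly below `𝔪`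
  have h𝔐nm : 𝔐 ∉ minimalPrimes Γ(Z, O) := fun h => by
    have h0 : 𝔐.height = 0 := Ideal.height_eq_zero_iff.mpr h
    rw [h0] at h𝔐ht
    exact zero_ne_one h𝔐ht
  obtain ⟨𝔓, h𝔓min, h𝔓le⟩ := Ideal.exists_minimalPrimes_le (I := (⊥ : Ideal Γ(Z, O))) (J := 𝔐) bot_le
  haveI : 𝔓.IsPrime := h𝔓min.1.1
  have h𝔓lt : 𝔓 < 𝔐 := lt_of_le_of_ne h𝔓le fun h => h𝔐nm (h ▸ h𝔓min)
  have hlt : 𝔓.comap (algebraMap Γ(Z', W.1) Γ(Z, O)) < 𝔪 := by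
    have h := Ideal.IsIntegral.comap_lt_comap (R := Γ(Z', W.1)) h𝔓lt
    rwa [h𝔐𝔪] at h
  have hge : 1 ≤ 𝔪.height := by
    have h := Ideal.height_strict_mono_of_isPrime hlt
    exact Order.one_le_iff_pos.mpr (lt_of_le_of_lt bot_le h)
  have : 𝔪.height = 1 := le_antisymm hle hge
  rw [this]
  rfl

/-! ### §3 The field case -/

include hq in
/-- **The quotient of a smooth curve over a perfect field by a finite group is a smooth curve** (modulo
the ring-level statement `hRing`): for `κ` perfect, `p : Z → Z'` an affine geometric quotient by the
finite group `G`, `t : Z' → Spec κ` locally of finite type with `p ≫ t` smooth of relative dimension `1`,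
`t` is smooth of relative dimension `1` (smooth by §1; relative dimension read at the closed points,
§2 and ★ `Dimension.smoothOfRelativeDimension_of_forall_isClosed_ringKrullDim_stalk_eq`).
[cite: SGA1, Exp. V §1, Prop. 1.8] [cite: GortzWedhorn2020, Prop. 6.42 and Lemma 6.26] -/
theorem smoothOfRelativeDimension_one_of_field [Finite G] [PerfectField κ] [IsAffineHom p]
    [SmoothOfRelativeDimension 1 (p ≫ t)] [LocallyOfFiniteType t]
    (hRing : ∀ (l A : Type u) [Field l] [PerfectField l] [CommRing A] [Algebra l A]
      [Algebra.FiniteType l A] [IsReduced A] [MulSemiringAction G A] [SMulCommClass G l A],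
      (∀ m : Ideal A, [m.IsMaximal] → IsDomain (Localization.AtPrime m)) →
      (∀ m : Ideal A, [m.IsMaximal] → IsIntegrallyClosed (Localization.AtPrime m)) →
      ringKrullDim A ≤ 1 → Algebra.Smooth l ↥(FixedPoints.subalgebra l A G)) :
    SmoothOfRelativeDimension 1 t := by
  haveI : Smooth t := hq.smooth_of_field t hRing
  exact Dimension.smoothOfRelativeDimension_of_forall_isClosed_ringKrullDim_stalk_eq t 1
    fun z hz => hq.ringKrullDim_stalk_eq_one_of_isClosed t hz

end ActionOver.IsGeometricQuotient

/-- **The field case in the shape of the hypothesis `hfield` of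
★ `ActionOver.smoothOfRelativeDimension_one_gluedDesc_of_fieldCase`** (all binders explicit, the
action `ρZ : ActionOver p G` over the quotient map), modulo the ring-level statement `hRing`.
[cite: SGA1, Exp. V §1, Prop. 1.8] [cite: GortzWedhorn2020, Prop. 6.42] -/
theorem ActionOver.fieldCase_of_ring {G : Type u} [Group G] [Finite G]
    (hRing : ∀ (l A : Type u) [Field l] [PerfectField l] [CommRing A] [Algebra l A]
      [Algebra.FiniteType l A] [IsReduced A] [MulSemiringAction G A] [SMulCommClass G l A],
      (∀ m : Ideal A, [m.IsMaximal] → IsDomain (Localization.AtPrime m)) →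
      (∀ m : Ideal A, [m.IsMaximal] → IsIntegrallyClosed (Localization.AtPrime m)) →
      ringKrullDim A ≤ 1 → Algebra.Smooth l ↥(FixedPoints.subalgebra l A G))
    (κ : Type u) [Field κ] [PerfectField κ] ⦃Z Z' : Scheme.{u}⦄ (p : Z ⟶ Z') (ρZ : ActionOver p G)
    (t : Z' ⟶ Spec (.of κ)) (hq : ρZ.IsGeometricQuotient p) (hp : IsAffineHom p)
    (hs : SmoothOfRelativeDimension 1 (p ≫ t)) (ht : LocallyOfFiniteType t) :
    SmoothOfRelativeDimension 1 t :=
  hq.smoothOfRelativeDimension_one_of_field t hRing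

end Literature.AlgebraicGeometry.RelativeSpec

end
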